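/-
Origin: expansion seat `planner-pub-hodgecm-pv08-0`, handover v2 2026-08-18T03:56:56Z (`HOME/pub-hodgecm-pv08/lean/Pv08/OpenInputsN19.lean`, md5 82734ae9, 109 lines);
landed by the gen-5 packager in gate run 20 as `HodgeCM/PerL34/OpenInputsN19.lean` (verbatim).
-/
/-
Copyright: pub-hodgecm formalisation cell (harness21, 2026). New file (not vendored).
Origin: unit pub-hodgecm-pv08 (DAG-NODE PROVER #08), node N19 addendum.
Proposed place: `HodgeCM/PerL34/OpenInputsN19.lean`.
-/
import Summits.HodgeConjecture.HodgeCM.PerL34.S12Wedges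

/-!
# The two Lemma-3.5 open inputs of `ThetaModel.Inputs`, BY NAME, from the node-N19 residuals

Run 18 fixed the names `ThetaModel.Open_thetaGen12` / `ThetaModel.Open_thetaReal34` (PerL v5 Lemma 3.5
`lem:S12`, seesaw direction for the pair (12) and generation direction, closure form, for the pair (34);
`HodgeCM/Automorphic/ThetaFacts.lean` :174, :188).  `S12Wedges.lean` (node N19) proved both inclusions of
Lemma 3.5(i) for an arbitrary side `(D, k, l)` from two finer RESIDUAL statements:

* `N19w_genIdentityAllowed T V c D k l` — the seesaw generator identity (PerL ll. 372–375 with Lemma 3.4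
  (eq:seesaw), node N17): every wedge-function `Λ_Γ(ω, ω')` of theta one-forms of types `Ψ_k, Ψ_l` IS a
  generator `ϑ_{T,χ}(Φ)` with `χ` allowed; equivalently (`N19w_genIdentityAllowed_of`) the bare identity
  `N19w_genIdentity` plus node N31's output `N19_charsIn` (= the body of `Open_chars` for the side);
* `N19g_core T V c D k l` — the finite-sum core on a dense subspace (PerL ll. 356–372: for `Φ ∈ pr_κ(𝒫)`,
  `𝒫` the Fock polynomials, `ϑ_{T,χ}(Φ)` is a finite linear combination of wedge-functions), from which the
  closure form follows by density and the continuity AX5b (`N19g_of`).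

This file records the two implications with the open inputs as NAMED conclusions, so that the audited list can
replace `Open_thetaGen12` by the (12)-side generator identity and `Open_thetaReal34` by the (34)-side finite-sum
core whenever those are supplied (by a model of the Weil representation, or as refereed PerL statements):

* `open_thetaGen12_of_genIdentityAllowed` : (∀ good contexts, `N19w_genIdentityAllowed … (T.t12 V c) 0 1`) → `T.Open_thetaGen12`;
* `open_thetaGen12_of_genIdentity`        : (∀ good contexts, `N19w_genIdentity … (T.t12 V c) 0 1`) → `T.Open_chars` → `T.Open_thetaGen12`;
* `open_thetaReal34_of_core`              : (∀ good contexts, `N19g_core … (T.t34 V c) 2 3`) → `T.Open_thetaReal34`;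
* `open_thetaReal34_of_genIn`             : the (34)-side (gen ⊆ closed wedge span) inclusion itself, per context, is
  literally the body of `Open_thetaReal34` (definitional unfolding, recorded for the audit trail).

Nothing is posited; no new data.  Imports `Mathlib` + `HodgeCM.*` only (via `S12Wedges`).
-/

noncomputable section

open scoped InnerProductSpace

namespace HodgeCM
namespace PerL34

variable {U : Universe} (T : U.ThetaModel)

/-- **`Open_thetaGen12` from the (12)-side seesaw generator identity with allowed characters** (PerL v5 Lemma 3.5,
ll. 372–375: "conversely every such wedge is a generator"). -/
theorem open_thetaGen12_of_genIdentityAllowed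
    (h : ∀ {L : CMField} {ι₁ : L →+* ℂ} (V : HermSpace3 L ι₁) (c : SeesawCtx L), T.GoodCtx ι₁ c →
      N19w_genIdentityAllowed T V c (T.t12 V c) 0 1) :
    T.Open_thetaGen12 := by
  intro L ι₁ V c hc Γ ω₁ ω₂ h₁ h₂
  exact N19w_of_allowedIdentity T V c (T.t12 V c) 0 1 (h V c hc) Γ ω₁ ω₂ h₁ h₂

/-- **`Open_thetaGen12` from the bare (12)-side generator identity (node N17 residue) and `Open_chars` (node N31).** -/
theorem open_thetaGen12_of_genIdentity
    (hgen : ∀ {L : CMField} {ι₁ : L →+* ℂ} (V : HermSpace3 L ι₁) (c : SeesawCtx L), T.GoodCtx ι₁ c →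
      N19w_genIdentity T V c (T.t12 V c) 0 1)
    (hch : T.Open_chars) :
    T.Open_thetaGen12 := by
  intro L ι₁ V c hc Γ ω₁ ω₂ h₁ h₂
  exact N19w_of T V c (T.t12 V c) 0 1 (hgen V c hc) (hch V c hc).1 Γ ω₁ ω₂ h₁ h₂

/-- **`Open_thetaReal34` from the (34)-side finite-sum core on a dense subspace** (PerL v5 ll. 356–372), by
density and the continuity AX5b (`N19g_of`). -/
theorem open_thetaReal34_of_core
    (h : ∀ {L : CMField} {ι₁ : L →+* ℂ} (V : HermSpace3 L ι₁) (c : SeesawCtx L), T.GoodCtx ι₁ c →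
      N19g_core T V c (T.t34 V c) 2 3) :
    T.Open_thetaReal34 := by
  intro L ι₁ V c hc χ hχ Φ
  exact N19g_of T V c (T.t34 V c) 2 3 (h V c hc) χ hχ Φ

/-- The body of `Open_thetaReal34` at a good context IS the (34)-side inclusion `N19_genIn T V c (T.t34 V c) 2 3`
(definitional; recorded so the audit can quote node N19's name for the open input). -/
theorem open_thetaReal34_of_genIn
    (h : ∀ {L : CMField} {ι₁ : L →+* ℂ} (V : HermSpace3 L ι₁) (c : SeesawCtx L), T.GoodCtx ι₁ c →
      N19_genIn T V c (T.t34 V c) 2 3) :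
    T.Open_thetaReal34 :=
  fun V c hc => h V c hc

/-- Conversely the open input gives the (34)-side inclusion in every good context (so the two are the same
statement, context by context). -/
theorem genIn34_of_open_thetaReal34 (h : T.Open_thetaReal34) {L : CMField} {ι₁ : L →+* ℂ}
    (V : HermSpace3 L ι₁) (c : SeesawCtx L) (hc : T.GoodCtx ι₁ c) :
    N19_genIn T V c (T.t34 V c) 2 3 :=
  h V c hc

/-- … and `Open_thetaGen12` gives the (12)-side (wedge ⊆ S) inclusion in every good context. -/
theorem wedgeIn12_of_open_thetaGen12 (h : T.Open_thetaGen12) {L : CMField} {ι₁ : L →+* ℂ}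
    (V : HermSpace3 L ι₁) (c : SeesawCtx L) (hc : T.GoodCtx ι₁ c) :
    N19_wedgeIn T V c (T.t12 V c) 0 1 :=
  fun Γ ω ω' hω hω' => h V c hc Γ ω ω' hω hω'

/-- **Both Lemma-3.5 open inputs at once from node N19's verbatim statement on both sides** (Lemma 3.5(i):
`S₁₂ = closed span of (12)-wedges`, `S₃₄ = closed span of (34)-wedges`, in every good context). -/
theorem open_thetaGen12_and_Real34_of_N19
    (h : ∀ {L : CMField} {ι₁ : L →+* ℂ} (V : HermSpace3 L ι₁) (c : SeesawCtx L), T.GoodCtx ι₁ c →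
      N19_statement T V c (T.t12 V c) 0 1 ∧ N19_statement T V c (T.t34 V c) 2 3) :
    T.Open_thetaGen12 ∧ T.Open_thetaReal34 := by
  refine ⟨?_, ?_⟩
  · intro L ι₁ V c hc Γ ω₁ ω₂ h₁ h₂
    exact (N19_consumed T V c (h V c hc).1 (h V c hc).2).1 Γ ω₁ ω₂ h₁ h₂
  · intro L ι₁ V c hc χ hχ Φ
    exact (N19_consumed T V c (h V c hc).1 (h V c hc).2).2 χ hχ Φ

end PerL34
end HodgeCM

end
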